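import Literature.Analysis.FluidPDE.Tao2016AveragedNS.SplitDelayCircuit
import Literature.Analysis.FluidPDE.Tao2016AveragedNS.CircuitShadowing
import HarnessLib

/-!
# Tao 2016, §5.5 with the squared modes doubled, II: the split delay circuit is globally well
# posed, its synchronised trajectory IS Theorem 5.3's trajectory on the diagonal, and its
# pseudo-orbits project to pseudo-orbits of (5.5) — Theorem 5.3 for the doubled circuit, one epoch

T. Tao, *Finite time blowup for an averaged three-dimensional Navier–Stokes equation*, J. Amer.
Math. Soc. **29** (2016) 601–674 = arXiv:1402.0290v3, §5 (ode)–(g-cancel) p. 25, §5.5 (5.5)–(5.6)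
and Theorem 5.3 p. 28 [`Tao2016AveragedNS`]; E. Hairer, S. P. Nørsett, G. Wanner, *Solving Ordinary
Differential Equations I*, Thm I.10.2 (the fundamental lemma) [`HairerNorsettWanner1993`].

HONEST FRAMING (cell harvest/h2-tao-ladder, rung 1 of a ladder of MODEL equations; LADDER.md §2.1
(A-1.3)/(A-1.3b), §7.3, RUNG1-HANDOFF h4 "seven-mode Theorem 5.3♯ as a standalone theorem is the
natural first landing"): finite-dimensional ODE theory about the square-free nine-mode variant
`splitDelayCircuit` of Tao's toy circuit (5.5) (`SplitDelayCircuit.lean`). ONE EPOCH only: nothing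
here is the shell induction of §6, nothing certifies the rung, nothing concerns Navier–Stokes.

## What is proved (all kernel-checked; no named fact)

* WELL-POSEDNESS: `splitDelayCircuit` is smooth (`contDiff_splitDelayCircuit`) and cancelling, hence
  globally well posed (`splitDelayCircuit_exists_solution`, `splitDelayCircuit_solution_unique`, from
  the tree's `IsCancelling.exists_solution` / `.solution_unique`); `splitDelaySolution K ε` := THE
  trajectory from the synchronised datum `diagEmbed delayInit = (1/√2, 1/√2, 0, …, 0)`.
* EXACT DIAGONAL = THEOREM 5.3: `splitDelaySolution_eq_diagEmbed`: the synchronised trajectory IS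
  `t ↦ diagEmbed (delaySolution K ε t)` (diagonal invariance `hasDerivAt_diagEmbed` + uniqueness); so
  its asymmetry vanishes identically (`asymPart_splitDelaySolution`), its symmetric part IS Tao's
  trajectory (`symPart_splitDelaySolution`), and **`splitDelaySolution_hasAbruptTransition`**: with the
  constants of the tree's PROVED Theorem 5.3 (`delaySolution_hasAbruptTransition`), for `K ≥ K₀`,
  `0 < ε ≤ ε₁(K)` the symmetric part of the synchronised split trajectory makes the delayed abrupt
  energy transition (`HasAbruptTransition C K`) — Theorem 5.3♯ on the exact diagonal.
* OFF THE DIAGONAL, WITH FORCING (the shape the §6 induction consumes): sup-norm bookkeeping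
  `norm_symPart_le` / `norm_asymPart_le` (`≤ √2‖X‖`), `norm_symCorrection_le`
  (`≤ C_Q‖Y‖²`, `C_Q = splitCorrectionConst K ε = ε⁻² + ε + ε⁻¹K¹⁰ + ε²e^{-K¹⁰} + K`),
  `norm_asymField_le` (`≤ C_L‖S‖‖Y‖`, `C_L = asymFieldConst K ε = ε + ε²e^{-K¹⁰} + 2ε⁻² + ε⁻¹K¹⁰ + K`);
  **`IsPseudoOrbit.symPart_split`**: a `δ`-pseudo-orbit `X` of the split circuit on `[0,T]` in the
  sup-ball `R` whose asymmetry is bounded by `η` projects to a `(√2δ + C_Qη²)`-pseudo-orbit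
  `symPart ∘ X` of (5.5) in any ball `R' ≥ √2R` (by the EXACT reduction `symPart_splitDelayCircuit`);
  **`IsPseudoOrbit.asymPart_le_gronwallBound`**: along such a pseudo-orbit the asymmetry obeys the LINEAR
  Grönwall bound `‖Y(t)‖ ≤ gronwallBound ‖Y(0)‖ (C_L√2R) (√2δ) t` (by `asymPart_splitDelayCircuit`:
  the asymmetry equations are linear in `Y` with coefficients bounded by `C_L‖S‖`) — an
  `n₀`-free, `(K, ε, R, T)`-dependent amplification, exponential in `ε⁻²RT`;
  **`splitPseudoOrbit_delayedAbruptTransition`**: hence (Theorem 5.3 along pseudo-orbits, tree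
  `pseudoOrbit_delayedAbruptTransition`) EVERY pseudo-orbit of the split circuit issued near the
  synchronised datum makes the delayed abrupt transition in its symmetric part, up to the shadowing
  error `gronwallBound δ₀ (delayLipschitz K ε R') (√2δ + C_Qη²) t`, with `η` the asymmetry bound.
  In words: for ONE epoch the doubled circuit behaves as Tao's whenever `√2δ + C_Q η²` is below the
  gate's shadow radius; the asymmetry `η` itself is at most `e^{C_L√2RT}(η₀ + √2δT)`. Both constants
  are astronomically large in `ε⁻²` but INDEPENDENT of the shell index — which is what the cell's
  Y-budget (KIV-YRECAST / ATTEMPT-p1g2) needs: the source `δ, η₀` is `O((1+ε₀)^{-n₀/2})` and `n₀` is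
  chosen last.

NOT proved here: any `n₀`-free constant better than Grönwall's (the channel-by-channel bounds of the
Y-budget), anything about the §6 induction, anything about Navier–Stokes.
-/

noncomputable section

open Set Metric
open scoped NNReal

namespace Literature.Analysis.FluidPDE.Tao2016AveragedNS

variable {m : ℕ}

/-! ## Smoothness and global well-posedness of the split circuit -/

/-- A cross pump is a polynomial, hence smooth, vector field. [folklore] -/
private theorem contDiff_crossPumpOn (κ : ℝ) (i i' j : Fin m) {n : WithTop ℕ∞} :
    ContDiff ℝ n (crossPumpOn κ i i' j) := by
  have h1 : ContDiff ℝ n fun X : Fin m → ℝ => -(κ * X i' * X j) := by fun_prop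
  have h2 : ContDiff ℝ n fun X : Fin m → ℝ => -(κ * X i * X j) := by fun_prop
  have h3 : ContDiff ℝ n fun X : Fin m → ℝ => 2 * κ * X i * X i' := by fun_prop
  exact (((contDiff_single (𝕜 := ℝ) (F' := fun _ : Fin m => ℝ) n i).comp h1).add
    ((contDiff_single (𝕜 := ℝ) (F' := fun _ : Fin m => ℝ) n i').comp h2)).add
    ((contDiff_single (𝕜 := ℝ) (F' := fun _ : Fin m => ℝ) n j).comp h3)

/-- A split amplifier is smooth. [folklore] -/
private theorem contDiff_splitAmplifierOn (κ : ℝ) (i j j' : Fin m) {n : WithTop ℕ∞} :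
    ContDiff ℝ n (splitAmplifierOn κ i j j') := by
  have h1 : ContDiff ℝ n fun X : Fin m → ℝ => -(2 * κ * X j * X j') := by fun_prop
  have h2 : ContDiff ℝ n fun X : Fin m → ℝ => κ * X i * X j' := by fun_prop
  have h3 : ContDiff ℝ n fun X : Fin m → ℝ => κ * X i * X j := by fun_prop
  exact (((contDiff_single (𝕜 := ℝ) (F' := fun _ : Fin m => ℝ) n i).comp h1).add
    ((contDiff_single (𝕜 := ℝ) (F' := fun _ : Fin m => ℝ) n j).comp h2)).add
    ((contDiff_single (𝕜 := ℝ) (F' := fun _ : Fin m => ℝ) n j').comp h3)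

/-- The split circuit is a smooth vector field (superposition of eight smooth gates,
`splitDelayCircuit_eq_gates`). [cite: Tao2016AveragedNS, §5.5 (5.5)] -/
theorem contDiff_splitDelayCircuit (K ε : ℝ) {n : WithTop ℕ∞} :
    ContDiff ℝ n (splitDelayCircuit K ε) := by
  rw [splitDelayCircuit_eq_gates]
  exact (((((((contDiff_crossPumpOn _ _ _ _).add (contDiff_crossPumpOn _ _ _ _)).add
    (contDiff_crossPumpOn _ _ _ _)).add (contDiff_splitAmplifierOn _ _ _ _)).add
    (contDiff_rotorOn _ _ _ _)).add (contDiff_rotorOn _ _ _ _)).add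
    (contDiff_crossPumpOn _ _ _ _)).add (contDiff_crossPumpOn _ _ _ _)

/-- **Global existence** for the split circuit through every state (cancelling `C¹` field: the
tree's `IsCancelling.exists_solution`, §5 p. 25 "the flow (ode) preserves the norm of `X`, and so the
ODE is globally well posed"). [cite: Tao2016AveragedNS, §5 (ode)–(g-cancel)] -/
theorem splitDelayCircuit_exists_solution (K ε : ℝ) (x₀ : Fin 9 → ℝ) :
    ∃ X : ℝ → Fin 9 → ℝ, X 0 = x₀ ∧ ∀ t, HasDerivAt X (splitDelayCircuit K ε (X t)) t :=
  (isCancelling_splitDelayCircuit K ε).exists_solution (contDiff_splitDelayCircuit K ε) x₀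

/-- **Uniqueness**: global trajectories of the split circuit are determined by their state at time
`0`. [cite: Tao2016AveragedNS, §5 (ode)–(g-cancel)] -/
theorem splitDelayCircuit_solution_unique (K ε : ℝ) {X Y : ℝ → Fin 9 → ℝ}
    (hX : ∀ t, HasDerivAt X (splitDelayCircuit K ε (X t)) t)
    (hY : ∀ t, HasDerivAt Y (splitDelayCircuit K ε (Y t)) t) (h : X 0 = Y 0) : X = Y :=
  (isCancelling_splitDelayCircuit K ε).solution_unique (contDiff_splitDelayCircuit K ε) hX hY h

/-- **The synchronised trajectory** of the split circuit: THE solution from the symmetric datum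
`diagEmbed delayInit` (both copies of the input mode loaded with `1/√2`).
[cite: Tao2016AveragedNS, §5.5 (5.5)–(5.6)] -/
def splitDelaySolution (K ε : ℝ) : ℝ → Fin 9 → ℝ :=
  (splitDelayCircuit_exists_solution K ε (diagEmbed delayInit)).choose

/-- The synchronised trajectory starts at `diagEmbed delayInit`. [cite: Tao2016AveragedNS, §5.5 (5.6)] -/
theorem splitDelaySolution_zero (K ε : ℝ) : splitDelaySolution K ε 0 = diagEmbed delayInit :=
  (splitDelayCircuit_exists_solution K ε (diagEmbed delayInit)).choose_spec.1

/-- The synchronised trajectory solves the split circuit at every real time.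
[cite: Tao2016AveragedNS, §5.5 (5.5)] -/
theorem hasDerivAt_splitDelaySolution (K ε t : ℝ) :
    HasDerivAt (splitDelaySolution K ε) (splitDelayCircuit K ε (splitDelaySolution K ε t)) t :=
  (splitDelayCircuit_exists_solution K ε (diagEmbed delayInit)).choose_spec.2 t

/-! ## The exact diagonal: the synchronised trajectory IS Theorem 5.3's trajectory -/

/-- **The synchronised split trajectory is the diagonal image of Tao's trajectory**:
`splitDelaySolution K ε = diagEmbed ∘ delaySolution K ε` (the diagonal embedding of `delaySolution`
solves the split circuit by `hasDerivAt_diagEmbed`, and solutions are unique).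
[cite: Tao2016AveragedNS, §5.5 (5.5)–(5.6)] -/
theorem splitDelaySolution_eq_diagEmbed (K ε : ℝ) :
    splitDelaySolution K ε = fun t => diagEmbed (delaySolution K ε t) :=
  splitDelayCircuit_solution_unique K ε (hasDerivAt_splitDelaySolution K ε)
    (fun t => hasDerivAt_diagEmbed (hasDerivAt_delaySolution K ε t))
    (by rw [splitDelaySolution_zero, delaySolution_zero])

/-- Along the synchronised trajectory the asymmetry vanishes identically (the two copies of each
doubled mode stay equal for all time). [cite: Tao2016AveragedNS, §5.5 (5.5)] -/
theorem asymPart_splitDelaySolution (K ε t : ℝ) : asymPart (splitDelaySolution K ε t) = 0 := by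
  rw [splitDelaySolution_eq_diagEmbed]
  exact asymPart_diagEmbed _

/-- The symmetric part of the synchronised trajectory IS Tao's `(a,b,c,d,ã)(t)`.
[cite: Tao2016AveragedNS, §5.5 (5.5)–(5.6)] -/
theorem symPart_splitDelaySolution (K ε t : ℝ) :
    symPart (splitDelaySolution K ε t) = delaySolution K ε t := by
  rw [splitDelaySolution_eq_diagEmbed]
  exact symPart_diagEmbed _

/-- The synchronised trajectory keeps the energy `1`. [cite: Tao2016AveragedNS, §5.5 (energy-con)] -/
theorem energy_splitDelaySolution (K ε t : ℝ) : energy (splitDelaySolution K ε t) = 1 := by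
  rw [splitDelaySolution_eq_diagEmbed, energy_diagEmbed, energy_delaySolution]

/-- **Theorem 5.3 for the doubled circuit, exact diagonal (PROVED).** With the absolute constant
`C`, the threshold `K₀` and `ε₁(K)` of the tree's proof of Theorem 5.3
(`delaySolution_hasAbruptTransition`): for `K ≥ K₀` and `0 < ε ≤ ε₁(K)` the symmetric part
`(S_a, b, S_c, S_d, S_ã)` of the synchronised split trajectory makes the delayed abrupt energy
transition — `S_a = 1 + O(K⁻¹⁰)`, the rest `O(K⁻¹⁰)` before `t_c - K^{-1/2}`; `S_ã = 1 + O(K⁻¹⁰)`, the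
rest `O(K⁻¹⁰)` after `t_c + K^{-1/2}`, `t_c = √2 + O(K^{-1/2})` — while every asymmetry is `0`
(`asymPart_splitDelaySolution`). [cite: Tao2016AveragedNS, Theorem 5.3] -/
theorem splitDelaySolution_hasAbruptTransition :
    ∃ C : ℝ, 0 < C ∧ ∃ K₀ : ℝ, 0 < K₀ ∧ ∀ K : ℝ, K₀ ≤ K → ∃ ε₁ : ℝ, 0 < ε₁ ∧
      ∀ ε : ℝ, 0 < ε → ε ≤ ε₁ →
        HasAbruptTransition C K (fun t => symPart (splitDelaySolution K ε t)) := by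
  obtain ⟨C, hC, K₀, hK₀, h⟩ := delaySolution_hasAbruptTransition
  refine ⟨C, hC, K₀, hK₀, fun K hK => ?_⟩
  obtain ⟨ε₁, hε₁, hε⟩ := h K hK
  refine ⟨ε₁, hε₁, fun ε hε0 hεle => ?_⟩
  have hfun : (fun t => symPart (splitDelaySolution K ε t)) = delaySolution K ε :=
    funext fun t => symPart_splitDelaySolution K ε t
  rw [hfun]
  exact hε ε hε0 hεle

/-! ## Sup-norm bookkeeping for the symmetric / antisymmetric coordinates -/

/-- A coordinate is bounded by the sup norm. [folklore] -/
private theorem abs_apply_le_norm {n : ℕ} (X : Fin n → ℝ) (i : Fin n) : |X i| ≤ ‖X‖ := by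
  simpa [Real.norm_eq_abs] using norm_le_pi_norm X i

/-- `|xy| ≤ r²` when `|x|, |y| ≤ r`. [folklore] -/
private theorem abs_mul_le_sq {x y r : ℝ} (hx : |x| ≤ r) (hy : |y| ≤ r) : |x * y| ≤ r ^ 2 := by
  rw [abs_mul, sq]
  exact mul_le_mul hx hy (abs_nonneg _) ((abs_nonneg _).trans hx)

/-- `1 ≤ √2`. [folklore] -/
private theorem one_le_sqrt_two : (1 : ℝ) ≤ Real.sqrt 2 := by
  rw [show (1 : ℝ) = Real.sqrt 1 by simp]
  exact Real.sqrt_le_sqrt (by norm_num)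

/-- `|(√2/2)(x ± y)| ≤ √2 r` when `|x|, |y| ≤ r`. [folklore] -/
private theorem abs_half_sqrt_two_mul_le {z r : ℝ} (hz : |z| ≤ 2 * r) :
    |Real.sqrt 2 / 2 * z| ≤ Real.sqrt 2 * r := by
  rw [abs_mul, abs_of_nonneg (by positivity)]
  nlinarith [Real.sqrt_nonneg 2]

/-- **`‖symPart X‖ ≤ √2 ‖X‖`** (sup norms). [cite: Tao2016AveragedNS, §5 (ode)] -/
theorem norm_symPart_le (X : Fin 9 → ℝ) : ‖symPart X‖ ≤ Real.sqrt 2 * ‖X‖ := by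
  have h := abs_apply_le_norm X
  have hX : 0 ≤ ‖X‖ := norm_nonneg _
  refine (pi_norm_le_iff_of_nonneg (by positivity)).2 fun l => ?_
  rw [Real.norm_eq_abs]
  fin_cases l
  · simp only [symPart, Fin.zero_eta, Fin.isValue, Matrix.cons_val_zero]
    exact abs_half_sqrt_two_mul_le ((abs_add_le _ _).trans (by linarith [h 0, h 1]))
  · simp only [symPart, Fin.mk_one, Fin.isValue, Matrix.cons_val_one, Matrix.cons_val_zero]
    nlinarith [h 2, one_le_sqrt_two]
  · simp only [symPart, Fin.reduceFinMk, Fin.isValue, Matrix.cons_val]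
    exact abs_half_sqrt_two_mul_le ((abs_add_le _ _).trans (by linarith [h 3, h 4]))
  · simp only [symPart, Fin.reduceFinMk, Fin.isValue, Matrix.cons_val]
    exact abs_half_sqrt_two_mul_le ((abs_add_le _ _).trans (by linarith [h 5, h 6]))
  · simp only [symPart, Fin.reduceFinMk, Fin.isValue, Matrix.cons_val]
    exact abs_half_sqrt_two_mul_le ((abs_add_le _ _).trans (by linarith [h 7, h 8]))

/-- **`‖asymPart X‖ ≤ √2 ‖X‖`** (sup norms). [cite: Tao2016AveragedNS, §5 (ode)] -/
theorem norm_asymPart_le (X : Fin 9 → ℝ) : ‖asymPart X‖ ≤ Real.sqrt 2 * ‖X‖ := by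
  have h := abs_apply_le_norm X
  have hX : 0 ≤ ‖X‖ := norm_nonneg _
  refine (pi_norm_le_iff_of_nonneg (by positivity)).2 fun l => ?_
  rw [Real.norm_eq_abs]
  fin_cases l
  · simp only [asymPart, Fin.zero_eta, Fin.isValue, Matrix.cons_val_zero]
    exact abs_half_sqrt_two_mul_le ((abs_sub _ _).trans (by linarith [h 0, h 1]))
  · simp only [asymPart, Fin.mk_one, Fin.isValue, Matrix.cons_val_one, Matrix.cons_val_zero]
    exact abs_half_sqrt_two_mul_le ((abs_sub _ _).trans (by linarith [h 3, h 4]))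
  · simp only [asymPart, Fin.reduceFinMk, Fin.isValue, Matrix.cons_val]
    exact abs_half_sqrt_two_mul_le ((abs_sub _ _).trans (by linarith [h 5, h 6]))
  · simp only [asymPart, Fin.reduceFinMk, Fin.isValue, Matrix.cons_val]
    exact abs_half_sqrt_two_mul_le ((abs_sub _ _).trans (by linarith [h 7, h 8]))

/-- `symPart` is additive-subtractive (it is linear). [cite: Tao2016AveragedNS, §5 (ode)] -/
theorem symPart_sub (X X' : Fin 9 → ℝ) : symPart (X - X') = symPart X - symPart X' := by
  ext l; fin_cases l <;> simp [symPart] <;> ring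

/-- `asymPart` is additive-subtractive (it is linear). [cite: Tao2016AveragedNS, §5 (ode)] -/
theorem asymPart_sub (X X' : Fin 9 → ℝ) : asymPart (X - X') = asymPart X - asymPart X' := by
  ext l; fin_cases l <;> simp [asymPart] <;> ring

/-- `symPart` as a continuous linear map (for the chain rule). [cite: Tao2016AveragedNS, §5 (ode)] -/
def symPartL : (Fin 9 → ℝ) →L[ℝ] (Fin 5 → ℝ) :=
  LinearMap.toContinuousLinearMap
    { toFun := symPart
      map_add' := fun X X' => by ext l; fin_cases l <;> simp [symPart] <;> ring
      map_smul' := fun c X => by ext l; fin_cases l <;> simp [symPart] <;> ring }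

/-- `asymPart` as a continuous linear map. [cite: Tao2016AveragedNS, §5 (ode)] -/
def asymPartL : (Fin 9 → ℝ) →L[ℝ] (Fin 4 → ℝ) :=
  LinearMap.toContinuousLinearMap
    { toFun := asymPart
      map_add' := fun X X' => by ext l; fin_cases l <;> simp [asymPart] <;> ring
      map_smul' := fun c X => by ext l; fin_cases l <;> simp [asymPart] <;> ring }

/-- `symPartL` is `symPart`. [folklore] -/
@[simp] private theorem symPartL_apply (X : Fin 9 → ℝ) : symPartL X = symPart X := rfl

/-- `asymPartL` is `asymPart`. [folklore] -/
@[simp] private theorem asymPartL_apply (X : Fin 9 → ℝ) : asymPartL X = asymPart X := rfl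

/-- Chain rule: the symmetric part of a right-differentiable path. [folklore] -/
private theorem hasDerivWithinAt_symPart {X : ℝ → Fin 9 → ℝ} {V : Fin 9 → ℝ} {s : Set ℝ} {t : ℝ}
    (h : HasDerivWithinAt X V s t) :
    HasDerivWithinAt (fun τ => symPart (X τ)) (symPart V) s t := by
  exact (symPartL.hasFDerivAt (x := X t)).comp_hasDerivWithinAt t h

/-- Chain rule: the antisymmetric part of a right-differentiable path. [folklore] -/
private theorem hasDerivWithinAt_asymPart {X : ℝ → Fin 9 → ℝ} {V : Fin 9 → ℝ} {s : Set ℝ} {t : ℝ}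
    (h : HasDerivWithinAt X V s t) :
    HasDerivWithinAt (fun τ => asymPart (X τ)) (asymPart V) s t := by
  exact (asymPartL.hasFDerivAt (x := X t)).comp_hasDerivWithinAt t h

/-- The constant `C_Q = ε⁻² + ε + ε⁻¹K¹⁰ + ε²e^{-K¹⁰} + K` bounding the quadratic correction
`symCorrection`: the sum of the moduli of the five couplings of (5.5). [cite: Tao2016AveragedNS, §5.5 (5.5)] -/
def splitCorrectionConst (K ε : ℝ) : ℝ :=
  (ε ^ 2)⁻¹ + ε + ε⁻¹ * K ^ 10 + ε ^ 2 * Real.exp (-K ^ 10) + K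

/-- The constant `C_L = ε + ε²e^{-K¹⁰} + 2ε⁻² + ε⁻¹K¹⁰ + K` bounding the linear asymmetry field
`asymField` by `C_L ‖S‖ ‖Y‖`. [cite: Tao2016AveragedNS, §5.5 (5.5)] -/
def asymFieldConst (K ε : ℝ) : ℝ :=
  ε + ε ^ 2 * Real.exp (-K ^ 10) + 2 * (ε ^ 2)⁻¹ + ε⁻¹ * K ^ 10 + K

/-- **`‖symCorrection K ε Y‖ ≤ C_Q ‖Y‖²`**: the correction to (5.5) is quadratically small in the
asymmetry. [cite: Tao2016AveragedNS, §5.5 (5.5)] -/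
theorem norm_symCorrection_le {K ε : ℝ} (hK : 0 ≤ K) (hε : 0 < ε) (Y : Fin 4 → ℝ) :
    ‖symCorrection K ε Y‖ ≤ splitCorrectionConst K ε * ‖Y‖ ^ 2 := by
  have h := abs_apply_le_norm Y
  set r := ‖Y‖ with hr
  have hr0 : 0 ≤ r := norm_nonneg _
  have p := fun i j => abs_mul_le_sq (h i) (h j)
  have hq : ∀ i, |Y i ^ 2| ≤ r ^ 2 := fun i => by rw [sq (Y i)]; exact p i i
  have c1 : 0 ≤ (ε ^ 2)⁻¹ := by positivity
  have c2 : 0 ≤ ε := hε.le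
  have c3 : 0 ≤ ε⁻¹ * K ^ 10 := by positivity
  have c4 : 0 ≤ ε ^ 2 * Real.exp (-K ^ 10) := by positivity
  have hC : ∀ x : ℝ, 0 ≤ x → x ≤ splitCorrectionConst K ε →
      x * r ^ 2 ≤ splitCorrectionConst K ε * r ^ 2 :=
    fun x _ hx => mul_le_mul_of_nonneg_right hx (by positivity)
  refine (pi_norm_le_iff_of_nonneg (by unfold splitCorrectionConst; positivity)).2 fun l => ?_
  rw [Real.norm_eq_abs]
  fin_cases l
  · simp only [symCorrection, Fin.zero_eta, Fin.isValue, Matrix.cons_val_zero]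
    calc |(ε ^ 2)⁻¹ * Y 1 * Y 2| = (ε ^ 2)⁻¹ * |Y 1 * Y 2| := by
            rw [mul_assoc, abs_mul, abs_of_nonneg c1]
      _ ≤ (ε ^ 2)⁻¹ * r ^ 2 := mul_le_mul_of_nonneg_left (p 1 2) c1
      _ ≤ _ := hC _ c1 (by unfold splitCorrectionConst; linarith)
  · simp only [symCorrection, Fin.mk_one, Fin.isValue, Matrix.cons_val_one, Matrix.cons_val_zero]
    calc |-(ε * Y 0 ^ 2) + ε⁻¹ * K ^ 10 * Y 1 ^ 2|
          ≤ |-(ε * Y 0 ^ 2)| + |ε⁻¹ * K ^ 10 * Y 1 ^ 2| := abs_add_le _ _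
      _ = ε * |Y 0 ^ 2| + ε⁻¹ * K ^ 10 * |Y 1 ^ 2| := by
            rw [abs_neg, abs_mul, abs_mul, abs_of_nonneg c2, abs_of_nonneg c3]
      _ ≤ ε * r ^ 2 + ε⁻¹ * K ^ 10 * r ^ 2 :=
            add_le_add (mul_le_mul_of_nonneg_left (hq 0) c2) (mul_le_mul_of_nonneg_left (hq 1) c3)
      _ = (ε + ε⁻¹ * K ^ 10) * r ^ 2 := by ring
      _ ≤ _ := hC _ (by positivity) (by unfold splitCorrectionConst; linarith)
  · simp only [symCorrection, Fin.reduceFinMk, Fin.isValue, Matrix.cons_val]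
    calc |-(ε ^ 2 * Real.exp (-K ^ 10) * Y 0 ^ 2)| = ε ^ 2 * Real.exp (-K ^ 10) * |Y 0 ^ 2| := by
            rw [abs_neg, abs_mul, abs_of_nonneg c4]
      _ ≤ ε ^ 2 * Real.exp (-K ^ 10) * r ^ 2 := mul_le_mul_of_nonneg_left (hq 0) c4
      _ ≤ _ := hC _ c4 (by unfold splitCorrectionConst; linarith)
  · simp only [symCorrection, Fin.reduceFinMk, Fin.isValue, Matrix.cons_val]
    calc |-((ε ^ 2)⁻¹ * Y 0 * Y 1)| = (ε ^ 2)⁻¹ * |Y 0 * Y 1| := by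
            rw [abs_neg, mul_assoc, abs_mul, abs_of_nonneg c1]
      _ ≤ (ε ^ 2)⁻¹ * r ^ 2 := mul_le_mul_of_nonneg_left (p 0 1) c1
      _ ≤ _ := hC _ c1 (by unfold splitCorrectionConst; linarith)
  · simp only [symCorrection, Fin.reduceFinMk, Fin.isValue, Matrix.cons_val]
    calc |-(K * Y 2 ^ 2)| = K * |Y 2 ^ 2| := by rw [abs_neg, abs_mul, abs_of_nonneg hK]
      _ ≤ K * r ^ 2 := mul_le_mul_of_nonneg_left (hq 2) hK
      _ ≤ _ := hC _ hK (by unfold splitCorrectionConst; linarith)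

/-- **`‖asymField K ε S Y‖ ≤ C_L ‖S‖ ‖Y‖`**: the asymmetry field is linear in `Y` with coefficients
bounded by the couplings times the symmetric amplitudes. [cite: Tao2016AveragedNS, §5.5 (5.5)] -/
theorem norm_asymField_le {K ε : ℝ} (hK : 0 ≤ K) (hε : 0 < ε) (S : Fin 5 → ℝ) (Y : Fin 4 → ℝ) :
    ‖asymField K ε S Y‖ ≤ asymFieldConst K ε * ‖S‖ * ‖Y‖ := by
  have hS := abs_apply_le_norm S
  have hY := abs_apply_le_norm Y
  set s := ‖S‖ with hs
  set y := ‖Y‖ with hy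
  have hs0 : 0 ≤ s := norm_nonneg _
  have hy0 : 0 ≤ y := norm_nonneg _
  have p : ∀ i j, |S i * Y j| ≤ s * y := fun i j => by
    rw [abs_mul]; exact mul_le_mul (hS i) (hY j) (abs_nonneg _) hs0
  have c1 : 0 ≤ (ε ^ 2)⁻¹ := by positivity
  have c2 : 0 ≤ ε := hε.le
  have c3 : 0 ≤ ε⁻¹ * K ^ 10 := by positivity
  have c4 : 0 ≤ ε ^ 2 * Real.exp (-K ^ 10) := by positivity
  have hC : ∀ x : ℝ, 0 ≤ x → x ≤ asymFieldConst K ε →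
      x * (s * y) ≤ asymFieldConst K ε * s * y := by
    intro x _ hx
    rw [← mul_assoc]
    exact mul_le_mul_of_nonneg_right (mul_le_mul_of_nonneg_right hx hs0) hy0
  refine (pi_norm_le_iff_of_nonneg (by unfold asymFieldConst; positivity)).2 fun l => ?_
  rw [Real.norm_eq_abs]
  fin_cases l
  · simp only [asymField, Fin.zero_eta, Fin.isValue, Matrix.cons_val_zero]
    calc |ε * S 1 * Y 0 + ε ^ 2 * Real.exp (-K ^ 10) * S 2 * Y 0 - (ε ^ 2)⁻¹ * S 2 * Y 2 +
            (ε ^ 2)⁻¹ * S 3 * Y 1|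
          ≤ |ε * S 1 * Y 0| + |ε ^ 2 * Real.exp (-K ^ 10) * S 2 * Y 0| + |(ε ^ 2)⁻¹ * S 2 * Y 2| +
            |(ε ^ 2)⁻¹ * S 3 * Y 1| := by
            refine (abs_add_le _ _).trans (add_le_add ((abs_sub _ _).trans (add_le_add
              (abs_add_le _ _) le_rfl)) le_rfl)
      _ = ε * |S 1 * Y 0| + ε ^ 2 * Real.exp (-K ^ 10) * |S 2 * Y 0| + (ε ^ 2)⁻¹ * |S 2 * Y 2| +
            (ε ^ 2)⁻¹ * |S 3 * Y 1| := by
            simp only [mul_assoc, abs_mul, abs_of_nonneg c1, abs_of_nonneg c2,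
              abs_of_nonneg (pow_nonneg hε.le 2), abs_of_nonneg (Real.exp_pos _).le]
      _ ≤ ε * (s * y) + ε ^ 2 * Real.exp (-K ^ 10) * (s * y) + (ε ^ 2)⁻¹ * (s * y) +
            (ε ^ 2)⁻¹ * (s * y) := by
            gcongr
            exacts [p 1 0, p 2 0, p 2 2, p 3 1]
      _ = (ε + ε ^ 2 * Real.exp (-K ^ 10) + 2 * (ε ^ 2)⁻¹) * (s * y) := by ring
      _ ≤ _ := hC _ (by positivity) (by unfold asymFieldConst; linarith)
  · simp only [asymField, Fin.mk_one, Fin.isValue, Matrix.cons_val_one, Matrix.cons_val_zero]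
    calc |-(ε⁻¹ * K ^ 10 * S 1 * Y 1)| = ε⁻¹ * K ^ 10 * |S 1 * Y 1| := by
            rw [abs_neg, mul_assoc, abs_mul, abs_of_nonneg c3]
      _ ≤ ε⁻¹ * K ^ 10 * (s * y) := mul_le_mul_of_nonneg_left (p 1 1) c3
      _ ≤ _ := hC _ c3 (by unfold asymFieldConst; linarith)
  · simp only [asymField, Fin.reduceFinMk, Fin.isValue, Matrix.cons_val]
    calc |(ε ^ 2)⁻¹ * S 2 * Y 0 - (ε ^ 2)⁻¹ * S 0 * Y 1 + K * S 4 * Y 2|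
          ≤ |(ε ^ 2)⁻¹ * S 2 * Y 0| + |(ε ^ 2)⁻¹ * S 0 * Y 1| + |K * S 4 * Y 2| :=
            (abs_add_le _ _).trans (add_le_add (abs_sub _ _) le_rfl)
      _ = (ε ^ 2)⁻¹ * |S 2 * Y 0| + (ε ^ 2)⁻¹ * |S 0 * Y 1| + K * |S 4 * Y 2| := by
            simp only [mul_assoc, abs_mul, abs_of_nonneg c1, abs_of_nonneg hK]
      _ ≤ (ε ^ 2)⁻¹ * (s * y) + (ε ^ 2)⁻¹ * (s * y) + K * (s * y) := by
            gcongr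
            exacts [p 2 0, p 0 1, p 4 2]
      _ = (2 * (ε ^ 2)⁻¹ + K) * (s * y) := by ring
      _ ≤ _ := hC _ (by positivity) (by unfold asymFieldConst; linarith)
  · simp only [asymField, Fin.reduceFinMk, Fin.isValue, Matrix.cons_val, abs_zero]
    unfold asymFieldConst
    positivity

/-! ## Projection of pseudo-orbits and the linear Grönwall bound on the asymmetry -/

/-- **A pseudo-orbit of the split circuit projects to a pseudo-orbit of (5.5).** If `X` is a
`δ`-pseudo-orbit of `splitDelayCircuit K ε` on `[0,T]` in the sup-ball of radius `R`, and its
asymmetry is bounded by `η` on `[0,T)`, then `symPart ∘ X` is a `(√2δ + C_Qη²)`-pseudo-orbit of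
`delayCircuit K ε` in any sup-ball of radius `R' ≥ √2R`: the velocity defect of the projection is the
projected defect plus the EXACT quadratic correction `symCorrection (asymPart X)`
(`symPart_splitDelayCircuit`). [cite: HairerNorsettWanner1993, Thm I.10.2] -/
theorem IsPseudoOrbit.symPart_split {K ε δ T η : ℝ} {R R' : ℝ≥0} {X : ℝ → Fin 9 → ℝ}
    (hX : IsPseudoOrbit (splitDelayCircuit K ε) δ R T X) (hK : 0 ≤ K) (hε : 0 < ε)
    (hη : ∀ t ∈ Ico 0 T, ‖asymPart (X t)‖ ≤ η) (hR' : Real.sqrt 2 * (R : ℝ) ≤ R') :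
    IsPseudoOrbit (delayCircuit K ε) (Real.sqrt 2 * δ + splitCorrectionConst K ε * η ^ 2) R' T
      (fun t => symPart (X t)) where
  continuousOn := symPartL.continuous.comp_continuousOn hX.continuousOn
  defect := fun t ht => by
    obtain ⟨V, hV, hVδ⟩ := hX.defect t ht
    refine ⟨symPart V, hasDerivWithinAt_symPart hV, ?_⟩
    have hdec : symPart V - delayCircuit K ε (symPart (X t)) =
        symPart (V - splitDelayCircuit K ε (X t)) + symCorrection K ε (asymPart (X t)) := by
      rw [symPart_sub, symPart_splitDelayCircuit]; abel
    rw [hdec]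
    refine (norm_add_le _ _).trans (add_le_add ?_ ?_)
    · exact (norm_symPart_le _).trans (mul_le_mul_of_nonneg_left hVδ (Real.sqrt_nonneg _))
    · refine (norm_symCorrection_le hK hε _).trans ?_
      have h0 : 0 ≤ ‖asymPart (X t)‖ := norm_nonneg _
      exact mul_le_mul_of_nonneg_left (pow_le_pow_left₀ h0 (hη t ht) 2)
        (by unfold splitCorrectionConst; positivity)
  norm_le := fun t ht =>
    ((norm_symPart_le _).trans (mul_le_mul_of_nonneg_left (hX.norm_le t ht)
      (Real.sqrt_nonneg _))).trans hR'

/-- **The linear Grönwall bound on the asymmetry along a pseudo-orbit of the split circuit.** If `X`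
is a `δ`-pseudo-orbit of `splitDelayCircuit K ε` on `[0,T]` in the sup-ball of radius `R`, then for
`t ∈ [0,T]`: `‖asymPart (X t)‖ ≤ gronwallBound ‖asymPart (X 0)‖ (C_L·√2R) (√2δ) t` — the asymmetry
equations are LINEAR in the asymmetry (`asymPart_splitDelayCircuit`) with coefficients
`≤ C_L ‖symPart X‖ ≤ C_L√2R`, forced by the projected defect `≤ √2δ`. The amplification
`exp(C_L√2R·T)` depends on `(K, ε, R, T)` only. [cite: HairerNorsettWanner1993, Thm I.10.2] -/
theorem IsPseudoOrbit.asymPart_le_gronwallBound {K ε δ T : ℝ} {R : ℝ≥0} {X : ℝ → Fin 9 → ℝ}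
    (hX : IsPseudoOrbit (splitDelayCircuit K ε) δ R T X) (hK : 0 ≤ K) (hε : 0 < ε)
    {t : ℝ} (ht : t ∈ Icc 0 T) :
    ‖asymPart (X t)‖ ≤ gronwallBound ‖asymPart (X 0)‖
      (asymFieldConst K ε * (Real.sqrt 2 * R)) (Real.sqrt 2 * δ) t := by
  choose! V hV hVδ using hX.defect
  have hmain := norm_le_gronwallBound_of_norm_deriv_right_le (f := fun τ => asymPart (X τ))
    (f' := fun τ => asymPart (V τ)) (a := 0) (b := T) (δ := ‖asymPart (X 0)‖)
    (K := asymFieldConst K ε * (Real.sqrt 2 * R)) (ε := Real.sqrt 2 * δ)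
    (asymPartL.continuous.comp_continuousOn hX.continuousOn)
    (fun τ hτ => hasDerivWithinAt_asymPart (hV τ hτ)) le_rfl ?_
  · simpa using hmain t ht
  · intro τ hτ
    have hdec : asymPart (V τ) =
        asymPart (V τ - splitDelayCircuit K ε (X τ)) + asymField K ε (symPart (X τ)) (asymPart (X τ)) := by
      rw [asymPart_sub, asymPart_splitDelayCircuit]; abel
    rw [hdec]
    refine (norm_add_le _ _).trans ?_
    rw [add_comm]
    refine add_le_add ?_ ?_
    · refine (norm_asymField_le hK hε _ _).trans ?_
      have hS : ‖symPart (X τ)‖ ≤ Real.sqrt 2 * R :=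
        (norm_symPart_le _).trans (mul_le_mul_of_nonneg_left (hX.norm_le τ hτ) (Real.sqrt_nonneg _))
      have hC0 : 0 ≤ asymFieldConst K ε := by unfold asymFieldConst; positivity
      exact mul_le_mul_of_nonneg_right (mul_le_mul_of_nonneg_left hS hC0) (norm_nonneg _)
    · exact (norm_asymPart_le _).trans (mul_le_mul_of_nonneg_left (hVδ τ hτ) (Real.sqrt_nonneg _))

/-- **Theorem 5.3 along pseudo-orbits of the doubled circuit (one epoch, PROVED).** With the
absolute constant `C`, threshold `K₀` and `ε₁(K)` of the tree's Theorem 5.3: for `K ≥ K₀`,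
`0 < ε ≤ ε₁(K)`, every `δ`-pseudo-orbit `X` of `splitDelayCircuit K ε` on `[0,T]` in the sup-ball
`R`, whose symmetric part starts `δ₀`-close to (5.6) and whose asymmetry stays below `η`, has a
symmetric part `(S_a, b, S_c, S_d, S_ã)` exhibiting the delayed abrupt energy transition up to the
shadowing error `gronwallBound δ₀ (delayLipschitz K ε R') (√2δ + C_Qη²) t` (`R' ≥ max(1, √2R)`):
input `S_a = 1`, the rest `0` up to `C K⁻¹⁰ +` error before `t_c - K^{-1/2}`; output `S_ã = 1`, the
rest `0` up to the same after `t_c + K^{-1/2}`; `|t_c - √2| ≤ C K^{-1/2}`. The asymmetry bound `η` is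
supplied by `IsPseudoOrbit.asymPart_le_gronwallBound`. [cite: Tao2016AveragedNS, Theorem 5.3] -/
theorem splitPseudoOrbit_delayedAbruptTransition :
    ∃ C : ℝ, 0 < C ∧ ∃ K₀ : ℝ, 0 < K₀ ∧ ∀ K : ℝ, K₀ ≤ K → ∃ ε₁ : ℝ, 0 < ε₁ ∧
      ∀ ε : ℝ, 0 < ε → ε ≤ ε₁ → ∀ (R R' : ℝ≥0), 1 ≤ R' → Real.sqrt 2 * (R : ℝ) ≤ R' →
        ∀ (δ δ₀ η T : ℝ) (X : ℝ → Fin 9 → ℝ),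
        IsPseudoOrbit (splitDelayCircuit K ε) δ R T X → ‖symPart (X 0) - delayInit‖ ≤ δ₀ →
        (∀ t ∈ Ico 0 T, ‖asymPart (X t)‖ ≤ η) →
        ∃ tc : ℝ, |tc - Real.sqrt 2| ≤ C / Real.sqrt K ∧
          (∀ t ∈ Icc 0 T, t ≤ tc - 1 / Real.sqrt K →
            |symPart (X t) 0 - 1| ≤ C / K ^ 10 + gronwallBound δ₀ (delayLipschitz K ε R')
                (Real.sqrt 2 * δ + splitCorrectionConst K ε * η ^ 2) t ∧
            ∀ i : Fin 5, i ≠ 0 →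
              |symPart (X t) i| ≤ C / K ^ 10 + gronwallBound δ₀ (delayLipschitz K ε R')
                (Real.sqrt 2 * δ + splitCorrectionConst K ε * η ^ 2) t) ∧
          (∀ t ∈ Icc 0 T, tc + 1 / Real.sqrt K ≤ t →
            |symPart (X t) 4 - 1| ≤ C / K ^ 10 + gronwallBound δ₀ (delayLipschitz K ε R')
                (Real.sqrt 2 * δ + splitCorrectionConst K ε * η ^ 2) t ∧
            ∀ i : Fin 5, i ≠ 4 →
              |symPart (X t) i| ≤ C / K ^ 10 + gronwallBound δ₀ (delayLipschitz K ε R')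
                (Real.sqrt 2 * δ + splitCorrectionConst K ε * η ^ 2) t) := by
  obtain ⟨C, hC, K₀, hK₀, h⟩ := pseudoOrbit_delayedAbruptTransition
  refine ⟨C, hC, K₀, hK₀, fun K hK => ?_⟩
  obtain ⟨ε₁, hε₁, hε⟩ := h K hK
  refine ⟨ε₁, hε₁, fun ε hε0 hεle R R' hR' hRR' δ δ₀ η T X hX h0 hη => ?_⟩
  have hKnn : 0 ≤ K := (hK₀.le.trans hK)
  exact hε ε hε0 hεle R' hR' _ δ₀ T (fun t => symPart (X t))
    (hX.symPart_split hKnn hε0 hη hRR') h0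

end Literature.Analysis.FluidPDE.Tao2016AveragedNS
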